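import Mathlib
import Summits.NavierStokesRegularity.NavierStokesRegularity.Theorems.FilamentSkeletonRssKelvinGateSharpClosingSmooth

/-!
# Route `FilamentSkeletonRss` · crux `TransverseReduction1A` (stmt-NavierStokesRegularity-27414) — line `kelvin_gate` RE-THREADED in the
# SHARP SCALES: vocabulary, the two remaining stubs S1′/S2′ as `Prop`s, and the kernel-checked composition

Definitions + theorems (`--as helper`).  HONEST FRAMING: bookkeeping for a HYPOTHETICAL filament-type rotating-self-similar blow-up
route (refutation side); nothing here moves Navier–Stokes regularity; the two stub statements below are OPEN (S2′ is the crux) and are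
`def … : Prop`, never asserted; `TransverseReduction1A` is neither proved nor refuted.  Drafted by the 21221-p1 lane (g8) for the tenure
planner's re-thread (director-ns dss_73 (1)); the planner/registrar decides whether it becomes `Cruxes/TransverseReduction1A/Lines/…`.

Compared with the registered v4 line on the aside 21221 (`…KelvinGateDefs`: S1 dressing → S2 gate → S3 closing → S4 smoothing, box
families, accretion modes `D`, multipliers `B`): the re-typed crux has ONE skeleton, NO modes/multipliers and a FREE rate `α₁`; and in the
sharp scales S3 and S4 are THEOREMS (`SharpGateSpec.closing_smooth`).  So the line is

  S1′ `DressedBase1A` (dressing, AT THE FINAL RATE α₁ — memo FREE-GATE-SHARP-21221-g8 §10: the rate is not a perturbation parameter in any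
  decaying class) → S2′ `EventualSharpGate1A` (a `SharpGateSpec` at the dressed base with polynomial bound `A₀Γ^κ`, for dressing
  orders `k ≥ k₀`; KILL-FIRST, the crux) → [`SharpGateSpec.closing_smooth`] → `TransverseReduction1A` BY NAME (`TransverseReduction1A_of_sharp`).

Contents: §1 the crux cut at its arrows (`DefU1A … Clauses1A`, `Concl1A`; `transverseReduction1A_iff := Iff.rfl`); §2 `BaseSpec1A` (what a dressed
base must deliver: `α₁ ≠ 0`, `U⁰ ∈ C²` div-free, `P⁰ ∈ C¹`, `⟨y⟩‖U⁰‖, |P⁰| ≤ C_bΓ^{c_b}`, residual `E_{α₁}(U⁰)+∇P⁰ ∈ Y♯_{3/2}(C_rΓ^{-k})`,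
a unit of mass `‖U⁰(y₀)‖ ≥ 1`, waist closeness `η√Γ/2`); §3 the stubs; §4 the composition (thresholds via `rpow_gate_threshold`).
-/

set_option linter.dupNamespace false

noncomputable section

namespace Summit.NavierStokesRegularity.NavierStokesRegularity.Theorems.KelvinGate

open scoped BigOperators Topology InnerProductSpace RealInnerProductSpace ContDiff
open Filter Set Function MeasureTheory
open Literature.Analysis.FluidPDE
open Summit.NavierStokesRegularity.NavierStokesRegularity.Theses.FilamentSkeletonRss

/-! ## 1. The crux `TransverseReduction1A`, cut at its arrows (texts VERBATIM) -/

/-- Defining hypothesis 1 of `TransverseReduction1A`: `u` is the CORE-MATCHED regularised Biot–Savart field of a filament family. -/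
def DefU1A (N : ℕ) (Γ : ℝ) (γ : Fin N → ℝ) (Aa : Fin N → ℝ → ℝ)
    (u : (Fin N → ℝ → EuclideanSpace ℝ (Fin 3)) → EuclideanSpace ℝ (Fin 3) → EuclideanSpace ℝ (Fin 3)) : Prop :=
  ∀ Z y, u Z y = ∑ k, (Γ*γ k/(4*Real.pi))•∫ σ:ℝ, ((‖y-Z k σ‖^2+Real.exp (-(1+Real.eulerMascheroniConstant-Real.log 2))*Aa k σ)^(3/2:ℝ))⁻¹•cross (deriv (Z k) σ) (y-Z k σ)

/-- Defining hypothesis 2: the frame field `v = u(X) + ½y − α e₃ × y`. -/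
def DefV1A (N : ℕ) (α : ℝ) (X : Fin N → ℝ → EuclideanSpace ℝ (Fin 3))
    (u : (Fin N → ℝ → EuclideanSpace ℝ (Fin 3)) → EuclideanSpace ℝ (Fin 3) → EuclideanSpace ℝ (Fin 3))
    (v : EuclideanSpace ℝ (Fin 3) → EuclideanSpace ℝ (Fin 3)) : Prop :=
  ∀ y, v y = u X y+(1/2:ℝ)•y-α•cross (EuclideanSpace.single 2 1) y

/-- Defining hypothesis 3: the waist gradients `A_j = Dv(X_j(c_j))`. -/
def DefA1A (N : ℕ) (X : Fin N → ℝ → EuclideanSpace ℝ (Fin 3)) (c : Fin N → ℝ)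
    (v : EuclideanSpace ℝ (Fin 3) → EuclideanSpace ℝ (Fin 3)) (A : Fin N → (EuclideanSpace ℝ (Fin 3) →L[ℝ] EuclideanSpace ℝ (Fin 3))) : Prop :=
  ∀ j, A j = fderiv ℝ v (X j (c j))

/-- Defining hypothesis 4: the normal-tangency residual `T`. -/
def DefT1A (N : ℕ) (α : ℝ) (u : (Fin N → ℝ → EuclideanSpace ℝ (Fin 3)) → EuclideanSpace ℝ (Fin 3) → EuclideanSpace ℝ (Fin 3))
    (T : (Fin N → ℝ → EuclideanSpace ℝ (Fin 3)) → Fin N → ℝ → EuclideanSpace ℝ (Fin 3)) : Prop :=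
  ∀ Z j τ, T Z j τ = (u Z (Z j τ)+(1/2:ℝ)•Z j τ-α•cross (EuclideanSpace.single 2 1) (Z j τ))-(⟪u Z (Z j τ)+(1/2:ℝ)•Z j τ-α•cross (EuclideanSpace.single 2 1) (Z j τ), deriv (Z j) τ⟫_ℝ/‖deriv (Z j) τ‖^2)•deriv (Z j) τ

/-- The skeleton clauses of `TransverseReduction1A` (= those of `SkeletonJ1`), VERBATIM. -/
def Clauses1A (N : ℕ) (Γ δ ρ K Λ a b cnd Rw Rb cg θ₀ : ℝ) (γ : Fin N → ℝ) (α : ℝ) (X : Fin N → ℝ → EuclideanSpace ℝ (Fin 3))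
    (w : Fin N → ℝ → ℝ) (c : Fin N → ℝ) (m n : Fin N → EuclideanSpace ℝ (Fin 3)) (Aa : Fin N → ℝ → ℝ)
    (v : EuclideanSpace ℝ (Fin 3) → EuclideanSpace ℝ (Fin 3)) (A : Fin N → (EuclideanSpace ℝ (Fin 3) →L[ℝ] EuclideanSpace ℝ (Fin 3)))
    (T : (Fin N → ℝ → EuclideanSpace ℝ (Fin 3)) → Fin N → ℝ → EuclideanSpace ℝ (Fin 3)) : Prop :=
  (α ≠ 0 ∧ (∀ j, γ j ≠ 0)∧(∀ j, ContDiff ℝ 2 (X j) ∧ Differentiable ℝ (w j)∧(∀ τ, ‖deriv (X j) τ‖ = 1)∧(∀ τ, ‖iteratedDeriv 2 (X j) τ‖*√Γ≤K) ∧ Tendsto (fun τ => ‖X j τ‖) (cocompact ℝ) atTop)∧(∀ j k, j ≠ k → ∀ τ σ, ρ*√Γ≤‖X j τ-X k σ‖)∧(∀ j τ σ, ρ*√Γ≤|τ-σ| → cg*ρ*√Γ≤‖X j τ-X j σ‖)∧(∀ j τ, cg*|τ-c j|≤Rw*√Γ+‖X j τ‖)∧(∀ j τ, w j τ = ⟪v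 (X j τ), deriv (X j) τ⟫_ℝ)∧(∀ j τ, ‖X j τ‖≤Rb*√(Γ*Real.log Γ) → v (X j τ) = w j τ•deriv (X j) τ)∧(∀ j, ‖X j (c j)‖≤Rw*√Γ)∧(∀ j, |⟪deriv (X j) (c j), EuclideanSpace.single 2 1⟫_ℝ|≤1-θ₀)∧(θ₀≤|α| ∧ |α|≤θ₀⁻¹ ∧ ∀ j, θ₀≤|γ j| ∧ |γ j|≤θ₀⁻¹)∧(∀ j, w j (c j) = 0 ∧ (∀ τ, w j τ = 0 → τ = c j) ∧ 3/2+δ≤deriv (w j) (c j) ∧ deriv (w j) (c j)≤Λ)∧(∀ j, Differentiable ℝ (Aa j) ∧ (∀ τ, 0 < Aa j τ) ∧ ∀ τ, w j τ*deriv (Aa j) τ = (3/2-deriv (w j) τ)*Aa j τ+4)∧(∀ j, Orthonormal ℝ ![deriv (X j) (c j), m j, n j] ∧ ⟪A j (m j), m j⟫_ℝ+⟪A j (n j), n j⟫_ℝ < 0 ∧ ⟪A j (n j), m j⟫_ℝ * ⟪A j (m j), n j⟫_ℝ < ⟪A j (m j), m j⟫_ℝ * ⟪A j (n j), n j⟫_ℝ)∧(∀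 Y:Fin N → ℝ → EuclideanSpace ℝ (Fin 3), (∀ j, ContDiff ℝ 2 (Y j))→(∀ j τ, ⟪Y j τ, deriv (X j) τ⟫_ℝ = 0) → (∀ j τ, Rb*√(Γ*Real.log Γ) < ‖X j τ‖ → Y j τ = 0) → ∑ j, ⟪Y j (c j), cross (EuclideanSpace.single 2 1) (X j (c j))⟫_ℝ = 0 → (∀ j τ, ‖Y j τ‖+‖deriv (Y j) τ‖+‖iteratedDeriv 2 (Y j) τ‖≤(1+|τ-c j|)^b) → ∀ L:ℝ, (∀ j τ, ‖deriv (fun s:ℝ => T (fun k σ => X k σ+s•Y k σ) j τ) 0‖≤L*(1+|τ-c j|)^a) → ∀ j τ, ‖Y j τ‖≤cnd*L*(1+|τ-c j|)^b))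

/-- The conclusion block of `TransverseReduction1A` for a candidate `(α₁, C₀, M, U, P)`, VERBATIM. -/
def Concl1A (N : ℕ) (Γ ρ η Rw : ℝ) (X : Fin N → ℝ → EuclideanSpace ℝ (Fin 3))
    (u : (Fin N → ℝ → EuclideanSpace ℝ (Fin 3)) → EuclideanSpace ℝ (Fin 3) → EuclideanSpace ℝ (Fin 3))
    (α₁ C₀ M : ℝ) (U : EuclideanSpace ℝ (Fin 3) → EuclideanSpace ℝ (Fin 3)) (P : EuclideanSpace ℝ (Fin 3) → ℝ) : Prop :=
  α₁ ≠ 0 ∧ U ≠ 0 ∧ ContDiff ℝ (⊤:ℕ∞) U ∧ ContDiff ℝ (⊤:ℕ∞) P ∧ VectorCalculus.IsDivFree U∧(∀ y, α₁•(cross (EuclideanSpace.single 2 1) (U y)-fderiv ℝ U y (cross (EuclideanSpace.single 2 1) y))+(1/2:ℝ)•U y+(1/2:ℝ)•fderiv ℝ U y y-(Laplacian.laplacian U) y+fderiv ℝ U y (U y)+gradient P y = 0)∧(∀ y, ‖U y‖≤C₀/(1+‖y‖))∧(∀ y, |P y|≤M)∧(∀ y, ‖y‖≤Rw*√Γ →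 (∀ j τ, ρ*√Γ/4≤‖y-X j τ‖) → ‖U y-u X y‖≤η*√Γ)

/-- Sanity (definitional unfolding only): the crux IS `∀ box constants, ∃ Γ₁, ∀ Γ ≥ Γ₁, ∀ skeleton data, DefU1A → DefV1A → DefA1A → DefT1A →
Clauses1A → ∃ α₁ C₀ M U P, Concl1A`. -/
theorem transverseReduction1A_iff :
    TransverseReduction1A ↔ ∀ (N:ℕ) (δ ρ K Λ a b cnd η Rw Rb cg θ₀:ℝ), 0 < N → 0 < δ → 0 < ρ → 0 ≤ a → 0 < η → 0 < Rw → 0 < Rb → 0 < cg → 0 < θ₀ →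
      ∃ Γ₁:ℝ, ∀ Γ:ℝ, Γ₁≤Γ → ∀ (γ:Fin N → ℝ) (α:ℝ) (X:Fin N → ℝ → EuclideanSpace ℝ (Fin 3)) (w:Fin N → ℝ → ℝ) (c:Fin N → ℝ)
        (m n:Fin N → EuclideanSpace ℝ (Fin 3)) (Aa:Fin N → ℝ → ℝ) (u:(Fin N → ℝ → EuclideanSpace ℝ (Fin 3)) → EuclideanSpace ℝ (Fin 3) → EuclideanSpace ℝ (Fin 3))
        (v:EuclideanSpace ℝ (Fin 3) → EuclideanSpace ℝ (Fin 3)) (A:Fin N → (EuclideanSpace ℝ (Fin 3) →L[ℝ] EuclideanSpace ℝ (Fin 3)))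
        (T:(Fin N → ℝ → EuclideanSpace ℝ (Fin 3)) → Fin N → ℝ → EuclideanSpace ℝ (Fin 3)),
        DefU1A N Γ γ Aa u → DefV1A N α X u v → DefA1A N X c v A → DefT1A N α u T →
        Clauses1A N Γ δ ρ K Λ a b cnd Rw Rb cg θ₀ γ α X w c m n Aa v A T →
        ∃ (α₁ C₀ M:ℝ) (U:EuclideanSpace ℝ (Fin 3) → EuclideanSpace ℝ (Fin 3)) (P:EuclideanSpace ℝ (Fin 3) → ℝ), Concl1A N Γ ρ η Rw X u α₁ C₀ M U P :=
  Iff.rfl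

/-! ## 2. What a dressed base must deliver (sharp scales, internal weight `3/2`) -/

/-- **Dressed base of order `k`** for ONE skeleton at the FINAL rate `α₁`: `α₁ ≠ 0`; `U⁰ ∈ C²` divergence free, `P⁰ ∈ C¹`; size
`⟨y⟩‖U⁰‖ ≤ C_bΓ^{c_b}`, `|P⁰| ≤ C_bΓ^{c_b}`; the RESIDUAL `E_{α₁}(U⁰) + ∇P⁰` lies in `Y♯_{3/2}(C_rΓ^{-k})`; a unit of mass `‖U⁰(y₀)‖ ≥ 1`
somewhere; and `η√Γ/2`-closeness to the skeleton field on the waist ball off the `ρ√Γ/4`-tubes. -/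
def BaseSpec1A (k : ℕ) (Cb cb Cr : ℝ) (N : ℕ) (Γ ρ η Rw : ℝ) (X : Fin N → ℝ → EuclideanSpace ℝ (Fin 3))
    (u : (Fin N → ℝ → EuclideanSpace ℝ (Fin 3)) → EuclideanSpace ℝ (Fin 3) → EuclideanSpace ℝ (Fin 3))
    (α₁ : ℝ) (U0 : EuclideanSpace ℝ (Fin 3) → EuclideanSpace ℝ (Fin 3)) (P0 : EuclideanSpace ℝ (Fin 3) → ℝ) : Prop :=
  α₁ ≠ 0 ∧ ContDiff ℝ 2 U0 ∧ VectorCalculus.IsDivFree U0 ∧ ContDiff ℝ 1 P0 ∧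
  (∀ y, (1 + ‖y‖) * ‖U0 y‖ ≤ Cb * Γ ^ cb) ∧ (∀ y, |P0 y| ≤ Cb * Γ ^ cb) ∧
  YSharp (3/2:ℝ) (fun y => lerayOp α₁ U0 y + gradient P0 y) (Cr * Γ ^ (-(k:ℝ))) ∧
  (∃ y₀, 1 ≤ ‖U0 y₀‖) ∧
  (∀ y, ‖y‖ ≤ Rw * √Γ → (∀ j τ, ρ * √Γ / 4 ≤ ‖y - X j τ‖) → ‖U0 y - u X y‖ ≤ η * √Γ / 2)

/-! ## 3. The two stubs of the re-threaded line (as `Prop`s; never asserted here) -/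

/-- Statement of stub S1′ · `DressedBase1A` (size XL; matched asymptotics AT THE FINAL RATE): for all box constants there are size
constants `C_b, c_b` such that for EVERY order `k` there are `C_r, Γ₁` with: every skeleton satisfying the clauses at `Γ ≥ Γ₁` admits a rate
`α₁` and a dressed base `(U⁰, P⁰)` with `BaseSpec1A k C_b c_b C_r`. -/
def DressedBase1A : Prop :=
  ∀ (N:ℕ) (δ ρ K Λ a b cnd η Rw Rb cg θ₀:ℝ), 0 < N → 0 < δ → 0 < ρ → 0 ≤ a → 0 < η → 0 < Rw → 0 < Rb → 0 < cg → 0 < θ₀ →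
    ∃ Cb cb : ℝ, ∀ k : ℕ, ∃ Cr Γ₁ : ℝ, ∀ Γ:ℝ, Γ₁≤Γ → ∀ (γ:Fin N → ℝ) (α:ℝ) (X:Fin N → ℝ → EuclideanSpace ℝ (Fin 3)) (w:Fin N → ℝ → ℝ) (c:Fin N → ℝ)
      (m n:Fin N → EuclideanSpace ℝ (Fin 3)) (Aa:Fin N → ℝ → ℝ) (u:(Fin N → ℝ → EuclideanSpace ℝ (Fin 3)) → EuclideanSpace ℝ (Fin 3) → EuclideanSpace ℝ (Fin 3))
      (v:EuclideanSpace ℝ (Fin 3) → EuclideanSpace ℝ (Fin 3)) (A:Fin N → (EuclideanSpace ℝ (Fin 3) →L[ℝ] EuclideanSpace ℝ (Fin 3)))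
      (T:(Fin N → ℝ → EuclideanSpace ℝ (Fin 3)) → Fin N → ℝ → EuclideanSpace ℝ (Fin 3)),
      DefU1A N Γ γ Aa u → DefV1A N α X u v → DefA1A N X c v A → DefT1A N α u T →
      Clauses1A N Γ δ ρ K Λ a b cnd Rw Rb cg θ₀ γ α X w c m n Aa v A T →
      ∃ (α₁ : ℝ) (U0 : EuclideanSpace ℝ (Fin 3) → EuclideanSpace ℝ (Fin 3)) (P0 : EuclideanSpace ℝ (Fin 3) → ℝ),
        BaseSpec1A k Cb cb Cr N Γ ρ η Rw X u α₁ U0 P0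

/-- Statement of stub S2′ · `EventualSharpGate1A` (size XL; KILL-FIRST — the crux): for all box constants and size constants `C_b, c_b`
there are gate constants `κ, A₀` and an order `k₀` such that for every `k ≥ k₀` and every `C_r`, for `Γ ≥ Γ₂`, around EVERY dressed base of
`BaseSpec1A k C_b c_b C_r` the linearised profile operator `𝓛_(α₁,U⁰) + ∇` has a SHARP KELVIN GATE with bound `A₀Γ^κ`
(`SharpGateSpec (3/2) (A₀Γ^κ) α₁ U⁰ K 𝒬`: linear, `Y♯ → X♯ × C¹`, div-free, NO rate multiplier — memo §10). -/
def EventualSharpGate1A : Prop :=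
  ∀ (N:ℕ) (δ ρ K Λ a b cnd η Rw Rb cg θ₀:ℝ), 0 < N → 0 < δ → 0 < ρ → 0 ≤ a → 0 < η → 0 < Rw → 0 < Rb → 0 < cg → 0 < θ₀ →
    ∀ Cb cb : ℝ, ∃ κ A₀ : ℝ, ∃ k₀ : ℕ, ∀ k : ℕ, k₀ ≤ k → ∀ Cr : ℝ, ∃ Γ₂ : ℝ, ∀ Γ:ℝ, Γ₂≤Γ →
      ∀ (γ:Fin N → ℝ) (α:ℝ) (X:Fin N → ℝ → EuclideanSpace ℝ (Fin 3)) (w:Fin N → ℝ → ℝ) (c:Fin N → ℝ)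
      (m n:Fin N → EuclideanSpace ℝ (Fin 3)) (Aa:Fin N → ℝ → ℝ) (u:(Fin N → ℝ → EuclideanSpace ℝ (Fin 3)) → EuclideanSpace ℝ (Fin 3) → EuclideanSpace ℝ (Fin 3))
      (v:EuclideanSpace ℝ (Fin 3) → EuclideanSpace ℝ (Fin 3)) (A:Fin N → (EuclideanSpace ℝ (Fin 3) →L[ℝ] EuclideanSpace ℝ (Fin 3)))
      (T:(Fin N → ℝ → EuclideanSpace ℝ (Fin 3)) → Fin N → ℝ → EuclideanSpace ℝ (Fin 3)),
      DefU1A N Γ γ Aa u → DefV1A N α X u v → DefA1A N X c v A → DefT1A N α u T →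
      Clauses1A N Γ δ ρ K Λ a b cnd Rw Rb cg θ₀ γ α X w c m n Aa v A T →
      ∀ (α₁ : ℝ) (U0 : EuclideanSpace ℝ (Fin 3) → EuclideanSpace ℝ (Fin 3)) (P0 : EuclideanSpace ℝ (Fin 3) → ℝ),
        BaseSpec1A k Cb cb Cr N Γ ρ η Rw X u α₁ U0 P0 →
        ∃ (K : (EuclideanSpace ℝ (Fin 3) → EuclideanSpace ℝ (Fin 3)) → EuclideanSpace ℝ (Fin 3) → EuclideanSpace ℝ (Fin 3))
          (𝒬 : (EuclideanSpace ℝ (Fin 3) → EuclideanSpace ℝ (Fin 3)) → EuclideanSpace ℝ (Fin 3) → ℝ),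
          SharpGateSpec (3/2:ℝ) (A₀ * Γ ^ κ) α₁ U0 K 𝒬

/-! ## 4. The composition: S1′ + S2′ ⇒ `TransverseReduction1A` (S3′, S4′ are `SharpGateSpec.closing_smooth`) -/

/-- From a dressed base and a sharp gate with `16A²ε ≤ 1`, `2Aε ≤ 1/2`, `2Aε ≤ η√Γ/2`: the crux's conclusion block. -/
theorem concl1A_of_base_gate {k : ℕ} {Cb cb Cr : ℝ} {N : ℕ} {Γ ρ η Rw : ℝ} {X : Fin N → ℝ → EuclideanSpace ℝ (Fin 3)}
    {u : (Fin N → ℝ → EuclideanSpace ℝ (Fin 3)) → EuclideanSpace ℝ (Fin 3) → EuclideanSpace ℝ (Fin 3)} {α₁ A : ℝ}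
    {U0 : EuclideanSpace ℝ (Fin 3) → EuclideanSpace ℝ (Fin 3)} {P0 : EuclideanSpace ℝ (Fin 3) → ℝ}
    {K : (EuclideanSpace ℝ (Fin 3) → EuclideanSpace ℝ (Fin 3)) → EuclideanSpace ℝ (Fin 3) → EuclideanSpace ℝ (Fin 3)}
    {𝒬 : (EuclideanSpace ℝ (Fin 3) → EuclideanSpace ℝ (Fin 3)) → EuclideanSpace ℝ (Fin 3) → ℝ}
    (hb : BaseSpec1A k Cb cb Cr N Γ ρ η Rw X u α₁ U0 P0) (hg : SharpGateSpec (3/2:ℝ) A α₁ U0 K 𝒬)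
    (h16 : 16 * A ^ 2 * (Cr * Γ ^ (-(k:ℝ))) ≤ 1) (hhalf : 2 * A * (Cr * Γ ^ (-(k:ℝ))) ≤ 1 / 2)
    (hη : 2 * A * (Cr * Γ ^ (-(k:ℝ))) ≤ η * √Γ / 2) :
    ∃ (C₀ M : ℝ) (U : EuclideanSpace ℝ (Fin 3) → EuclideanSpace ℝ (Fin 3)) (P : EuclideanSpace ℝ (Fin 3) → ℝ),
      Concl1A N Γ ρ η Rw X u α₁ C₀ M U P := by
  obtain ⟨hα, hU0, hdiv0, hP0, hU0b, hP0b, hres, ⟨y₀, hy₀⟩, hwaist⟩ := hb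
  obtain ⟨W, Q, hX, hQb, hWb, hUs, hPs, hdiv, heq⟩ :=
    hg.closing_smooth (by norm_num) hU0 hdiv0 hP0 (r := fun y => lerayOp α₁ U0 y + gradient P0 y) (fun _ => rfl) hres h16
  set ε : ℝ := Cr * Γ ^ (-(k:ℝ)) with hε
  refine ⟨Cb * Γ ^ cb + 1, Cb * Γ ^ cb + 1, fun z => U0 z + W z, fun z => P0 z + Q z, hα, ?_, hUs, hPs, hdiv, heq, fun y => ?_,
    fun y => ?_, fun y hy htube => ?_⟩
  · -- `U ≠ 0`: at `y₀`, `‖U⁰ y₀‖ ≥ 1 > 1/2 ≥ ‖W y₀‖`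
    intro hzero
    have h0 : U0 y₀ + W y₀ = 0 := by simpa using congrFun hzero y₀
    have hW0 : ‖W y₀‖ ≤ 1 / 2 := by
      have h1 := hWb y₀
      have h2 : 2 * A * ε / (1 + ‖y₀‖) ≤ 2 * A * ε := div_le_self (by linarith [(hX.mono (le_refl _)).nonneg]) (by linarith [norm_nonneg y₀])
      linarith
    have : U0 y₀ = -W y₀ := eq_neg_of_add_eq_zero_left h0
    rw [this, norm_neg] at hy₀
    linarith
  · -- decay `‖U y‖ ≤ (C_bΓ^{c_b} + 1)/(1+|y|)`
    have hy1 : 0 < 1 + ‖y‖ := by positivity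
    rw [le_div_iff₀ hy1]
    have h1 : ‖U0 y‖ * (1 + ‖y‖) ≤ Cb * Γ ^ cb := by rw [mul_comm]; exact hU0b y
    have h2 : ‖W y‖ * (1 + ‖y‖) ≤ 2 * A * ε := by
      have := hWb y; rwa [le_div_iff₀ hy1] at this
    calc ‖U0 y + W y‖ * (1 + ‖y‖) ≤ (‖U0 y‖ + ‖W y‖) * (1 + ‖y‖) :=
          mul_le_mul_of_nonneg_right (norm_add_le _ _) hy1.le
      _ = ‖U0 y‖ * (1 + ‖y‖) + ‖W y‖ * (1 + ‖y‖) := by ring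
      _ ≤ Cb * Γ ^ cb + 1 := by linarith
  · -- pressure bound
    calc |P0 y + Q y| ≤ |P0 y| + |Q y| := abs_add_le _ _
      _ ≤ Cb * Γ ^ cb + 1 := by linarith [hP0b y, hQb y]
  · -- waist closeness
    have h2 : ‖W y‖ ≤ 2 * A * ε := (hWb y).trans (div_le_self (by linarith [hX.nonneg]) (by linarith [norm_nonneg y]))
    calc ‖U0 y + W y - u X y‖ = ‖(U0 y - u X y) + W y‖ := by abel_nf
      _ ≤ ‖U0 y - u X y‖ + ‖W y‖ := norm_add_le _ _
      _ ≤ η * √Γ / 2 + η * √Γ / 2 := add_le_add (hwaist y hy htube) (h2.trans hη)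
      _ = η * √Γ := by ring

/-- **Composition (pure logic + thresholds, no sorry).**  Dressing (S1′) + eventual sharp gate (S2′) give `TransverseReduction1A` BY NAME:
`C_b, c_b` from S1′ → `κ, A₀, k₀` from S2′ → `k := max k₀ (⌈2κ⌉₊ + 1)` → `C_r, Γ₁` (S1′), `Γ₂` (S2′) →
`Γ* := max (max Γ₁ Γ₂) (max 1 (16A₀²|C_r| + 4|A₀||C_r| + 8|A₀||C_r|/η + 1))`, then `SharpGateSpec.closing_smooth`. -/
theorem TransverseReduction1A_of_sharp (h1 : DressedBase1A) (h2 : EventualSharpGate1A) : TransverseReduction1A := by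
  refine transverseReduction1A_iff.mpr ?_
  intro N δ ρ K Λ a b cnd η Rw Rb cg θ₀ hN hδ hρ ha hη hRw hRb hcg hθ₀
  obtain ⟨Cb, cb, hS1⟩ := h1 N δ ρ K Λ a b cnd η Rw Rb cg θ₀ hN hδ hρ ha hη hRw hRb hcg hθ₀
  obtain ⟨κ, A₀, k₀, hS2⟩ := h2 N δ ρ K Λ a b cnd η Rw Rb cg θ₀ hN hδ hρ ha hη hRw hRb hcg hθ₀ Cb cb
  set k : ℕ := max k₀ (⌈2 * κ⌉₊ + 1) with hk
  have hk₀ : k₀ ≤ k := le_max_left _ _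
  have hk1 : 1 ≤ k := le_trans (Nat.le_add_left 1 _) (le_max_right _ _)
  have hk2 : 2 * κ + 1 ≤ (k : ℝ) := by
    have h1 : (⌈2 * κ⌉₊ : ℝ) + 1 ≤ (k : ℝ) := by
      have : ((⌈2 * κ⌉₊ + 1 : ℕ) : ℝ) ≤ (k : ℝ) := by exact_mod_cast le_max_right k₀ (⌈2 * κ⌉₊ + 1)
      push_cast at this; exact this
    linarith [Nat.le_ceil (2 * κ)]
  obtain ⟨Cr, Γ₁, hS1'⟩ := hS1 k
  obtain ⟨Γ₂, hS2'⟩ := hS2 k hk₀ Cr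
  set Γ₃ : ℝ := max 1 (16 * A₀ ^ 2 * |Cr| + 4 * |A₀| * |Cr| + 8 * |A₀| * |Cr| / η + 1) with hΓ₃
  refine ⟨max (max Γ₁ Γ₂) Γ₃, ?_⟩
  intro Γ hΓ γ α X w c m n Aa u v A T hu hv hA hT hcl
  have hΓ₁ : Γ₁ ≤ Γ := le_trans (le_trans (le_max_left _ _) (le_max_left _ _)) hΓ
  have hΓ₂ : Γ₂ ≤ Γ := le_trans (le_trans (le_max_right _ _) (le_max_left _ _)) hΓ
  have hΓ₃' : Γ₃ ≤ Γ := le_trans (le_max_right _ _) hΓ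
  have hΓ1 : 1 ≤ Γ := le_trans (le_max_left _ _) hΓ₃'
  have hΓbig : 16 * A₀ ^ 2 * |Cr| + 4 * |A₀| * |Cr| + 8 * |A₀| * |Cr| / η + 1 ≤ Γ := le_trans (le_max_right _ _) hΓ₃'
  have hΓ0 : 0 < Γ := by linarith
  obtain ⟨α₁, U0, P0, hbase⟩ := hS1' Γ hΓ₁ γ α X w c m n Aa u v A T hu hv hA hT hcl
  obtain ⟨Kop, Qop, hgate⟩ := hS2' Γ hΓ₂ γ α X w c m n Aa u v A T hu hv hA hT hcl α₁ U0 P0 hbase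
  -- thresholds
  obtain ⟨ht1, ht2⟩ := rpow_gate_threshold (κ := κ) hΓ1 hk2 hk1
  have hε0 : 0 ≤ Cr * Γ ^ (-(k:ℝ)) := hbase.2.2.2.2.2.2.1.nonneg
  have hΓinv : Γ⁻¹ * Γ = 1 := inv_mul_cancel₀ hΓ0.ne'
  have hCr : Cr ≤ |Cr| := le_abs_self Cr
  have hA₀ : A₀ ≤ |A₀| := le_abs_self A₀
  have hΓκ : 0 ≤ Γ ^ κ := Real.rpow_nonneg hΓ0.le κ
  have hΓk : 0 ≤ Γ ^ (-(k:ℝ)) := Real.rpow_nonneg hΓ0.le _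
  have hCr0 : 0 ≤ Cr := by
    have : 0 < Γ ^ (-(k:ℝ)) := Real.rpow_pos_of_pos hΓ0 _
    nlinarith
  have hnn1 : 0 ≤ 16 * A₀ ^ 2 * |Cr| := by positivity
  have hnn2 : 0 ≤ 4 * |A₀| * |Cr| := by positivity
  have hnn3 : 0 ≤ 8 * |A₀| * |Cr| / η := by positivity
  have hACr : A₀ * Cr ≤ |A₀| * |Cr| := by rw [← abs_mul]; exact le_abs_self _
  have h16 : 16 * (A₀ * Γ ^ κ) ^ 2 * (Cr * Γ ^ (-(k:ℝ))) ≤ 1 := by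
    have e : 16 * (A₀ * Γ ^ κ) ^ 2 * (Cr * Γ ^ (-(k:ℝ))) = 16 * A₀ ^ 2 * Cr * ((Γ ^ κ) ^ 2 * Γ ^ (-(k:ℝ))) := by ring
    rw [e]
    have h1 : 16 * A₀ ^ 2 * Cr * ((Γ ^ κ) ^ 2 * Γ ^ (-(k:ℝ))) ≤ 16 * A₀ ^ 2 * Cr * Γ⁻¹ :=
      mul_le_mul_of_nonneg_left ht1 (by positivity)
    have h3 : 16 * A₀ ^ 2 * Cr ≤ Γ := by
      have : 16 * A₀ ^ 2 * Cr ≤ 16 * A₀ ^ 2 * |Cr| := mul_le_mul_of_nonneg_left hCr (by positivity)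
      linarith
    have h2 : 16 * A₀ ^ 2 * Cr * Γ⁻¹ ≤ 1 := by
      rw [show 16 * A₀ ^ 2 * Cr * Γ⁻¹ = (16 * A₀ ^ 2 * Cr) / Γ by rw [div_eq_mul_inv], div_le_one hΓ0]
      exact h3
    exact h1.trans h2
  have h2Aε : 2 * (A₀ * Γ ^ κ) * (Cr * Γ ^ (-(k:ℝ))) ≤ 2 * |A₀| * |Cr| * Γ⁻¹ := by
    have e : 2 * (A₀ * Γ ^ κ) * (Cr * Γ ^ (-(k:ℝ))) = 2 * (A₀ * Cr) * (Γ ^ κ * Γ ^ (-(k:ℝ))) := by ring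
    rw [e]
    have h1 : 2 * (A₀ * Cr) * (Γ ^ κ * Γ ^ (-(k:ℝ))) ≤ 2 * (|A₀| * |Cr|) * (Γ ^ κ * Γ ^ (-(k:ℝ))) :=
      mul_le_mul_of_nonneg_right (mul_le_mul_of_nonneg_left hACr (by norm_num)) (mul_nonneg hΓκ hΓk)
    calc _ ≤ 2 * (|A₀| * |Cr|) * (Γ ^ κ * Γ ^ (-(k:ℝ))) := h1
      _ ≤ 2 * (|A₀| * |Cr|) * Γ⁻¹ := mul_le_mul_of_nonneg_left ht2 (by positivity)
      _ = 2 * |A₀| * |Cr| * Γ⁻¹ := by ring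
  have hdivΓ : 2 * |A₀| * |Cr| * Γ⁻¹ = (2 * |A₀| * |Cr|) / Γ := by rw [div_eq_mul_inv]
  have hhalf : 2 * (A₀ * Γ ^ κ) * (Cr * Γ ^ (-(k:ℝ))) ≤ 1 / 2 := by
    refine h2Aε.trans ?_
    rw [hdivΓ, div_le_iff₀ hΓ0]
    linarith
  have hηΓ : 2 * (A₀ * Γ ^ κ) * (Cr * Γ ^ (-(k:ℝ))) ≤ η * √Γ / 2 := by
    refine h2Aε.trans ?_
    have hsqrt : 1 ≤ √Γ := by rw [show (1:ℝ) = √1 by simp]; exact Real.sqrt_le_sqrt hΓ1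
    have h1 : 2 * |A₀| * |Cr| * Γ⁻¹ ≤ η / 2 := by
      rw [hdivΓ, div_le_iff₀ hΓ0]
      have e : 8 * |A₀| * |Cr| / η * η = 8 * |A₀| * |Cr| := div_mul_cancel₀ _ hη.ne'
      have h4 : 8 * |A₀| * |Cr| / η ≤ Γ := by linarith
      have h5 : 8 * |A₀| * |Cr| ≤ η * Γ := by
        calc 8 * |A₀| * |Cr| = 8 * |A₀| * |Cr| / η * η := e.symm
          _ ≤ Γ * η := mul_le_mul_of_nonneg_right h4 hη.le
          _ = η * Γ := mul_comm _ _
      linarith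
    calc 2 * |A₀| * |Cr| * Γ⁻¹ ≤ η / 2 := h1
      _ = η * 1 / 2 := by ring
      _ ≤ η * √Γ / 2 := by gcongr
  obtain ⟨C₀, M, U, P, hconcl⟩ := concl1A_of_base_gate hbase hgate h16 hhalf hηΓ
  exact ⟨α₁, C₀, M, U, P, hconcl⟩

end Summit.NavierStokesRegularity.NavierStokesRegularity.Theorems.KelvinGate

end
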